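import Summits.BirchSwinnertonDyer.BirchSwinnertonDyer.Theorems.ThetaPartnerAtTwoSignedControlAtTwoShaTwoOfBridgeOfLocalGlobal
import Summits.BirchSwinnertonDyer.BirchSwinnertonDyer.Theorems.SchneiderFreeAdditiveX3PoitouTateReciprocityEqualityHolds
import Summits.BirchSwinnertonDyer.BirchSwinnertonDyer.Theorems.SchneiderFreeAdditiveX3PoitouTateShaTwoLocalGlobalReal
import HarnessLib

/-!
# K4 `SignedControlAtTwo`, line `eulerchar` (skeleton v16): the LAST stub `stub_poitouTateShaRat` is a theorem —
# Poitou–Tate duality of `Ш¹(ℚ, M^D)` and `Ш²(ℚ, M)` (Milne ADT I Thm. 4.10 (a)) over `ℚ`, UNCONDITIONALLY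

Crux `stmt-BirchSwinnertonDyer-20309` (`Summit.BirchSwinnertonDyer.BirchSwinnertonDyer.Theses.ThetaPartnerAtTwo.SignedControlAtTwo`,
also wanted by `ResidualThetaTransportAtTwo`), registered skeleton `Cruxes/SignedControlAtTwo/Lines/eulerchar.lean` v16 (lead
`bsd-wall-tp2-p3` g6; ONE stub).  Its stub

  `stub_poitouTateShaRat : Literature.NumberTheory.GaloisCohomology.poitouTate_sha_tateDual ℚ`

(Milne, *ADT* I Thm. 4.10 (a) / Harari Thm. 17.13 (b): for every `n ≥ 1` and every finite discrete `n`-torsion `Γ_ℚ`-module `M`,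
`Ш¹(ℚ, M^D)` and `Ш²(ℚ, M)` are finite and perfectly paired into `ℤ/n`) is discharged here VERBATIM and UNCONDITIONALLY, as the
composition of three tree theorems landed today by three seats:

* this seat's `SignedEC.PoitouTateShaRat.poitouTate_sha_tateDual_rat_of_bridge_of_localGlobal'` (`…ShaTwoOfBridgeOfLocalGlobal`,
  p627784): the named fact over `ℚ` from the bridge (nat, R4=) and the local–global principle (A), with `SelmerComplement` :=
  cell bsd-schneider door-c4's `selmerComplement_canonical_holds`, Tate duality := `tateDualityHypotheses_classBarD_classBarInv`,
  idèle projections / (R3) := door-c5's `ideleProjection` / `ideleAssembly`, (B) := door-c5's `sha_hom_units_dies_in_idele`,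
  on top of seat bsd-line-chl-p2's `Ш²`-readout road (native obstruction map `shaTwoConnecting`) run at a field WITH a real place
  (`…ShaTwoReadoutRoadReal` / `…ShaTwoNativeAssemblyReal`, final step = lead bsd-wall-tp2-p3 g4's `sha_tateDual_of_readout_real`);
* cell bsd-schneider door-c5 g18's `PoitouTateReduction.hR4_ideleProjection` (`…ReciprocityEqualityHolds`, p629556): the bridge
  (nat, R4=) for THE idèle readout with `inv := classBarInv`, every number field, archimedean summands included (explicit inflation
  bijection `Ext¹_{C_Γ}(ℤ, M) ≃ H¹(K, M)`, door-c4's idèle package and cocycle transport, door-c5's `hRur_holds`);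
* cell bsd-schneider door-c4 g19's `PoitouTateShaTwoReadout.tateDual_localGlobal_real` (`…ShaTwoLocalGlobalReal`, p629062): (A) for
  every number field — Brauer–Hasse–Noether over `ℚ(M)` (real places included), inf–res, Hilbert 90 (chl-p2 g7's transport).

The lead replaces the `sorry` of `stub_poitouTateShaRat` in the skeleton by
`Summit.BirchSwinnertonDyer.BirchSwinnertonDyer.Theorems.SignedEC.PoitouTateShaRat.stub_poitouTateShaRat`; with stubs 1
(`SignedEC.PoitouTateSelmerRat.stub_poitouTateSelmerRat`, p625615) and 3 (`SignedEC.ShaThreeBrauer.stub_realThreeOrderTwoBase`, w3 g9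
p628282) already landed, line `eulerchar` has NO open stub.

Seat `bsd-inputs-k4-p1` (D-0154 (2) "prove the printed input"; `--supports stmt-BirchSwinnertonDyer-20309`).
BSD is not proved by this file; it removes the last named-fact input of one crux of one route.
-/

set_option linter.dupNamespace false
set_option autoImplicit false

namespace Summit.BirchSwinnertonDyer.BirchSwinnertonDyer.Theorems.SignedEC.PoitouTateShaRat

open Summit.BirchSwinnertonDyer.BirchSwinnertonDyer.Theorems.SchneiderFreeAdditiveX3.PoitouTateReduction (hR4_ideleProjection)
open Summit.BirchSwinnertonDyer.BirchSwinnertonDyer.Theorems.PoitouTateShaTwoReadout (tateDual_localGlobal_real)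

/-- **Stub 2 of K4 line `eulerchar` (skeleton v16), as a theorem**: Poitou–Tate duality of the Tate–Shafarevich groups over `ℚ` —
the named fact `poitouTate_sha_tateDual ℚ` (Milne, *ADT* I Thm. 4.10 (a); Harari Thm. 17.13 (b)): for every `n ≥ 1` and every finite
discrete `n`-torsion `Γ_ℚ`-module `M`, `Ш¹(ℚ, M^D)` and `Ш²(ℚ, M)` are finite and there is a bi-additive pairing
`Ш²(ℚ, M) × Ш¹(ℚ, M^D) → ℤ/n` both of whose adjoints are bijective.  UNCONDITIONAL: `poitouTate_sha_tateDual_rat_of_bridge_of_localGlobal'`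
fed with door-c5's `hR4_ideleProjection` (the bridge (nat, R4=) over `ℚ`, the real place included) and door-c4's
`tateDual_localGlobal_real` ((A) over `ℚ`).
[cite: MilneADT2006, Ch. I, Thm. 4.10 (a)(b) (proof, p. 58), Lemma 4.13][cite: Harari2020, Thm. 17.13 (b)] -/
theorem stub_poitouTateShaRat :
    Literature.NumberTheory.GaloisCohomology.poitouTate_sha_tateDual ℚ :=
  poitouTate_sha_tateDual_rat_of_bridge_of_localGlobal'
    (fun n _ _ _ _ _ _ _ ρ₀ hM => hR4_ideleProjection n ρ₀ hM)
    (fun n _ _ _ _ _ _ ρ₀ hM => tateDual_localGlobal_real ρ₀ n hM)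

/-- **Poitou–Tate duality of `Ш¹(K, M^D)` and `Ш²(K, M)` for EVERY number field `K`** (Milne, *ADT* I Thm. 4.10 (a), all finite
modules) — the named fact `poitouTate_sha_tateDual K`, UNCONDITIONALLY: this seat's any-`K` door
`PoitouTateShaTwoReadout.poitouTate_sha_tateDual_of_bridge_of_localGlobal'` fed with door-c5's `hR4_ideleProjection` and door-c4's
`tateDual_localGlobal_real` (re-export under the K4 namespace, for the sibling consumers over other fields, e.g. K4
`RedSplitControlAtThree` at a totally complex field and this seat's `shaTwo_primary_eq_bot_of_isTotallyComplex` / `_of_ne_two`).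
[cite: MilneADT2006, Ch. I, Thm. 4.10 (a)(b) (proof, p. 58), Lemma 4.13][cite: Harari2020, Thm. 17.13 (b)] -/
theorem poitouTate_sha_tateDual_numberField (K : Type) [Field K] [NumberField K] :
    Literature.NumberTheory.GaloisCohomology.poitouTate_sha_tateDual K :=
  Summit.BirchSwinnertonDyer.BirchSwinnertonDyer.Theorems.PoitouTateShaTwoReadout.poitouTate_sha_tateDual_of_bridge_of_localGlobal'
    (fun n _ _ _ _ _ _ _ ρ₀ hM => hR4_ideleProjection n ρ₀ hM)
    (fun n _ _ _ _ _ _ ρ₀ hM => tateDual_localGlobal_real ρ₀ n hM)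

end Summit.BirchSwinnertonDyer.BirchSwinnertonDyer.Theorems.SignedEC.PoitouTateShaRat
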